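import Summits.Langlands.Langlands.Theses.NonParallelVoid

/-!
# `ResidueParallel` (crux stmt-Langlands-17003, route `NonParallelVoid`): the hypothesis
# `ρ.toGaloisRep.IsIrreducible` is REDUNDANT — it follows from `¬` (invariant line at every `v ∣ p`)
# (negative-side support, refuter cdisprove seat; hypothesis-mutation finding, sorry-free)

`ResidueParallel` quantifies over continuous `ρ : Γ_F → GL₂(ℚ̄_p)` (`F` imaginary quadratic) with,
among others, the hypotheses `hirr : ρ.toGaloisRep.IsIrreducible` and
`hLR : ¬ ∀ v ∣ p, FramedRep.HasInvariantCompleteFlag (ρ.toLocal v)` ("`ρ` is not nearly ordinary at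
every place above `p`", the complement of crux `LocallyReducibleParallel`).  We record, kernel-checked,
that `hirr` carries no information beyond `hLR`:

* `exists_common_eigenvector_of_not_isIrreducible` — a reducible rank-`2` framed representation over a
  field has a common eigenvector `w ≠ 0` (a proper non-trivial subrepresentation of `K²` is a line);
* `hasInvariantCompleteFlag_of_common_eigenvector` — a common eigenvector gives an invariant complete
  flag in the tree's sense (`∃ P, P ρ P⁻¹` upper triangular: take `P⁻¹ = (w | u)`);
* `hasInvariantCompleteFlag_comp_of_not_isIrreducible` — hence every pull-back `ρ ∘ φ` of a reducible
  rank-`2` `ρ` has an invariant complete flag; in particular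
  `isIrreducible_of_not_forall_hasInvariantCompleteFlag`: for `ρ : Γ_F → GL₂(ℚ̄_p)` over a number
  field, if some `ρ|Γ_{F_v}` (`v ∣ p`) has no invariant line then `ρ` is irreducible;
* `residueParallel_iff_without_isIrreducible` — the crux is EQUIVALENT to the same statement with the
  binder `ρ.toGaloisRep.IsIrreducible →` deleted (stated inline; no proposition is defined under
  `Summits/`).

Moral for provers / planners: dropping `hirr` changes nothing; the only cheap non-parallel geometric
representations over an imaginary quadratic field — direct sums `χ₁ ⊕ χ₂` of algebraic Hecke
characters with unequal gaps (e.g. infinity types `(0,0)` and `(1,2)`) — are excluded by `hLR`, not by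
`hirr`, so no refutation of this crux can come from a reducible `ρ`, and no proof needs `hirr` beyond
`hLR`.  (For the line `inert-fl-transfer`: stubs 3–4 carry `hLR` and inherit this; stubs 1–2 do not,
but there `hirr` follows from the residual absolute irreducibility of `ρ|Γ_{F(ζ_p)}` in their regime
`U`, cf. `DyadicDihedralFM/Negative/IrreducibleRedundant`.)  This file does NOT refute the crux.
-/

noncomputable section

set_option linter.dupNamespace false

namespace Summit.Langlands.Langlands.Theorems.ResidueParallel.Negative

open Literature.NumberTheory.GaloisRepresentations
open scoped MatrixGroups Matrix

section LinAlg

variable {G : Type*} [Group G] [TopologicalSpace G] {K : Type*} [Field K] [TopologicalSpace K]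
  [IsTopologicalRing K]

/-- Frame change: if `Q` is invertible with first column `w` and `w` is a common eigenvector of all
`ρ g`, then `Q⁻¹ ρ Q` is upper triangular, so `ρ` has an invariant complete flag. -/
theorem hasInvariantCompleteFlag_of_common_eigenvector_aux (ρ : FramedRep G K 2) (w : Fin 2 → K)
    (h : ∀ g : G, ∃ c : K, ((ρ g : GL (Fin 2) K) : Matrix (Fin 2) (Fin 2) K) *ᵥ w = c • w)
    (Q : Matrix (Fin 2) (Fin 2) K) (hQ : IsUnit Q.det) (hQw : Q *ᵥ Pi.single 0 1 = w) :
    ρ.HasInvariantCompleteFlag := by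
  classical
  have hQU : IsUnit Q := (Matrix.isUnit_iff_isUnit_det Q).2 hQ
  refine ⟨hQU.unit⁻¹, fun g i j hij => ?_⟩
  -- in `Fin 2`, `j < i` forces `j = 0`, `i = 1`
  have hj : j = 0 := by omega
  have hi : i = 1 := by omega
  subst hj; subst hi
  obtain ⟨c, hc⟩ := h g
  -- the conjugated matrix
  have hmat : (FramedRep.conj hQU.unit⁻¹ ρ).matrixFn g =
      Q⁻¹ * ((ρ g : GL (Fin 2) K) : Matrix (Fin 2) (Fin 2) K) * Q := by
    simp only [FramedRep.matrixFn_apply, FramedRep.conj_apply, inv_inv, Units.val_mul,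
      Matrix.coe_units_inv, IsUnit.unit_spec]
  rw [hmat]
  -- entry (1,0) is the component 1 of the image of `e₀`
  have hcol : (Q⁻¹ * ((ρ g : GL (Fin 2) K) : Matrix (Fin 2) (Fin 2) K) * Q) *ᵥ Pi.single 0 1 =
      c • Pi.single 0 1 := by
    rw [← Matrix.mulVec_mulVec, ← Matrix.mulVec_mulVec, hQw, hc, Matrix.mulVec_smul, ← hQw,
      Matrix.mulVec_mulVec, Matrix.nonsing_inv_mul _ hQ, Matrix.one_mulVec]
  have := congrFun hcol 1
  simpa [Matrix.mulVec, dotProduct, Fin.sum_univ_two, Pi.single_apply] using this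

/-- A rank-2 framed representation with a common eigenvector `w ≠ 0` has an invariant complete flag. -/
theorem hasInvariantCompleteFlag_of_common_eigenvector (ρ : FramedRep G K 2) (w : Fin 2 → K)
    (hw : w ≠ 0)
    (h : ∀ g : G, ∃ c : K, ((ρ g : GL (Fin 2) K) : Matrix (Fin 2) (Fin 2) K) *ᵥ w = c • w) :
    ρ.HasInvariantCompleteFlag := by
  classical
  by_cases h0 : w 0 = 0
  · have h1 : w 1 ≠ 0 := by
      intro h1; apply hw; funext i; fin_cases i <;> simp [h0, h1]
    refine hasInvariantCompleteFlag_of_common_eigenvector_aux ρ w h !![w 0, 1; w 1, 0] ?_ ?_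
    · rw [Matrix.det_fin_two_of]; simp [h0, h1]
    · funext i; fin_cases i <;> simp [Matrix.mulVec, dotProduct, Pi.single_apply]
  · refine hasInvariantCompleteFlag_of_common_eigenvector_aux ρ w h !![w 0, 0; w 1, 1] ?_ ?_
    · rw [Matrix.det_fin_two_of]; simp [h0]
    · funext i; fin_cases i <;> simp [Matrix.mulVec, dotProduct, Pi.single_apply]

omit [IsTopologicalRing K] in
/-- A REDUCIBLE rank-2 framed representation over a field has a common eigenvector. -/
theorem exists_common_eigenvector_of_not_isIrreducible (ρ : FramedRep G K 2)
    (h : ¬ ρ.IsIrreducible) :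
    ∃ w : Fin 2 → K, w ≠ 0 ∧
      ∀ g : G, ∃ c : K, ((ρ g : GL (Fin 2) K) : Matrix (Fin 2) (Fin 2) K) *ᵥ w = c • w := by
  classical
  -- a proper non-trivial subrepresentation
  have hnt : Nontrivial (Subrepresentation ρ.toRepresentation) := by
    refine ⟨⟨⊥, ⊤, fun e => ?_⟩⟩
    have e' := congrArg Subrepresentation.toSubmodule e
    exact bot_ne_top e'
  have hex : ∃ W : Subrepresentation ρ.toRepresentation, W ≠ ⊥ ∧ W ≠ ⊤ := by
    by_contra hcon
    push Not at hcon
    exact h (IsSimpleOrder.mk fun W => (em (W = ⊥)).imp_right (hcon W))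
  obtain ⟨W, hWb, hWt⟩ := hex
  set S : Submodule K (Fin 2 → K) := W.toSubmodule with hS
  have hSb : S ≠ ⊥ := fun e => hWb (Subrepresentation.toSubmodule_injective e)
  have hSt : S ≠ ⊤ := fun e => hWt (Subrepresentation.toSubmodule_injective e)
  -- `dim S = 1`
  have hlt : Module.finrank K S < 2 := by
    have := Submodule.finrank_lt hSt
    simpa using this
  have hne : Module.finrank K S ≠ 0 := by
    rw [Ne, Submodule.finrank_eq_zero]; exact hSb
  have h1 : Module.finrank K S = 1 := by omega
  obtain ⟨w, hwS, hw0⟩ := Submodule.exists_mem_ne_zero_of_ne_bot hSb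
  refine ⟨w, hw0, fun g => ?_⟩
  have hw0' : (⟨w, hwS⟩ : S) ≠ 0 := fun e => hw0 (congrArg Subtype.val e)
  have hmem : ((ρ g : GL (Fin 2) K) : Matrix (Fin 2) (Fin 2) K) *ᵥ w ∈ S :=
    W.apply_mem_toSubmodule g hwS
  obtain ⟨c, hc⟩ := (finrank_eq_one_iff_of_nonzero' (⟨w, hwS⟩ : S) hw0').1 h1 ⟨_, hmem⟩
  exact ⟨c, (congrArg Subtype.val hc).symm⟩

/-- Reducible ⇒ every pullback `ρ ∘ φ` has an invariant complete flag. -/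
theorem hasInvariantCompleteFlag_comp_of_not_isIrreducible (ρ : FramedRep G K 2)
    (h : ¬ ρ.IsIrreducible) {H : Type*} [Group H] [TopologicalSpace H] (φ : H →ₜ* G) :
    FramedRep.HasInvariantCompleteFlag (ρ.comp φ) := by
  obtain ⟨w, hw0, hw⟩ := exists_common_eigenvector_of_not_isIrreducible ρ h
  exact hasInvariantCompleteFlag_of_common_eigenvector (ρ.comp φ) w hw0 fun g => hw (φ g)

end LinAlg

/-- **`¬` nearly-ordinary-somewhere forces irreducibility.** For a number field `F`, a prime `p` and
`ρ : Γ_F → GL₂(ℚ̄_p)`: if at some `v ∣ p` the local representation `ρ|Γ_{F_v}` has NO invariant line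
(no invariant complete flag), then `ρ` is irreducible. -/
theorem isIrreducible_of_not_forall_hasInvariantCompleteFlag {F : Type} [Field F] [NumberField F]
    {p : ℕ} [Fact p.Prime] (ρ : FramedGaloisRep F (PadicAlgCl p) 2)
    (h : ¬ ∀ v : IsDedekindDomain.HeightOneSpectrum (NumberField.RingOfIntegers F),
      ((p : ℕ) : NumberField.RingOfIntegers F) ∈ v.asIdeal →
        FramedRep.HasInvariantCompleteFlag (ρ.toLocal v)) :
    ρ.toGaloisRep.IsIrreducible := by
  by_contra hirr
  refine h fun v _ => ?_
  unfold FramedGaloisRep.toLocal FramedGaloisRep.restrictField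
  exact hasInvariantCompleteFlag_comp_of_not_isIrreducible ρ hirr _

/-- **`hirr` is redundant in `ResidueParallel`.** The crux is EQUIVALENT to the statement obtained by
deleting the binder `ρ.toGaloisRep.IsIrreducible →` (everything else verbatim): the hypothesis
"`ρ|Γ_{F_v}` has no invariant line at some `v ∣ p`" (`¬` nearly ordinary everywhere), which the crux
carries anyway, already forces irreducibility of `ρ` (a `Γ_F`-invariant line is `Γ_{F_v}`-invariant).
Hypothesis-mutation record for provers: no proof can use `hirr` essentially, and no refutation of this
crux can come from a reducible `ρ` (sums of algebraic Hecke characters of unequal gaps, the only cheap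
non-parallel geometric representations over an imaginary quadratic field, are excluded by `¬hLR`, not
by `hirr`). This file does NOT refute the crux. -/
theorem residueParallel_iff_without_isIrreducible :
    Summit.Langlands.Langlands.Theses.NonParallelVoid.ResidueParallel ↔
    (∀ (F : Type) [Field F] [NumberField F] [Algebra.IsQuadraticExtension ℚ F],
      NumberField.IsTotallyComplex F → ∀ (p : ℕ) [Fact p.Prime] (ρ :
      Literature.NumberTheory.GaloisRepresentations.FramedGaloisRep F (PadicAlgCl p) 2), (∀ᶠ v :
      IsDedekindDomain.HeightOneSpectrum (NumberField.RingOfIntegers F) in Filter.cofinite,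
      ρ.IsUnramifiedAt v) → (∀ (v : IsDedekindDomain.HeightOneSpectrum (NumberField.RingOfIntegers
      F)) (hv : ((p : ℕ) : NumberField.RingOfIntegers F) ∈ v.asIdeal),
      (Literature.NumberTheory.PAdicHodge.fontainePstAdicCompletion v p hv).IsDeRhamFramed
      (ρ.toLocal v) ∧ (letI := (Literature.NumberTheory.PAdicHodge.fontainePstAdicCompletion v p
      hv).algebra; ∀ τ : v.adicCompletion F →ₐ[ℚ_[p]] PadicAlgCl p, ∃ a b : ℤ, a < b ∧
      ρ.labelledHodgeTateWeightsAt v (Literature.NumberTheory.PAdicHodge.fontainePstAdicCompletion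
      v p hv).algebra (Literature.NumberTheory.PAdicHodge.fontainePstAdicCompletion v p hv).𝔅
      τ.toRingHom = {a, b})) → ¬ (∀ v : IsDedekindDomain.HeightOneSpectrum
      (NumberField.RingOfIntegers F), ((p : ℕ) : NumberField.RingOfIntegers F) ∈ v.asIdeal →
      Literature.NumberTheory.GaloisRepresentations.FramedRep.HasInvariantCompleteFlag (ρ.toLocal
      v)) → ¬ (11 ≤ p ∧ (∃ v w : IsDedekindDomain.HeightOneSpectrum (NumberField.RingOfIntegers F),
      v ≠ w ∧ ((p : ℕ) : NumberField.RingOfIntegers F) ∈ v.asIdeal ∧ ((p : ℕ) :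
      NumberField.RingOfIntegers F) ∈ w.asIdeal) ∧ (∀ (v : IsDedekindDomain.HeightOneSpectrum
      (NumberField.RingOfIntegers F)) (hv : ((p : ℕ) : NumberField.RingOfIntegers F) ∈ v.asIdeal),
      (Literature.NumberTheory.PAdicHodge.fontainePstAdicCompletion v p hv).IsCrystallineFramed
      (ρ.toLocal v)) ∧
      Literature.NumberTheory.GaloisRepresentations.FramedGaloisRep.IsResiduallyAbsIrreducible
      (ρ.restrictField (CyclotomicField p F))) → ∃ g : ℤ, ∀ (v : IsDedekindDomain.HeightOneSpectrum
      (NumberField.RingOfIntegers F)) (hv : ((p : ℕ) : NumberField.RingOfIntegers F) ∈ v.asIdeal),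
      letI := (Literature.NumberTheory.PAdicHodge.fontainePstAdicCompletion v p hv).algebra; ∀ τ :
      v.adicCompletion F →ₐ[ℚ_[p]] PadicAlgCl p, ∃ a : ℤ, ρ.labelledHodgeTateWeightsAt v
      (Literature.NumberTheory.PAdicHodge.fontainePstAdicCompletion v p hv).algebra
      (Literature.NumberTheory.PAdicHodge.fontainePstAdicCompletion v p hv).𝔅 τ.toRingHom = {a, a +
      g}) := by
  constructor
  · intro h F _ _ _ hF p _ ρ hunr hHT hLR hG
    exact h F hF p ρ (isIrreducible_of_not_forall_hasInvariantCompleteFlag ρ hLR) hunr hHT hLR hG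
  · intro h F _ _ _ hF p _ ρ _ hunr hHT hLR hG
    exact h F hF p ρ hunr hHT hLR hG

end Summit.Langlands.Langlands.Theorems.ResidueParallel.Negative

end
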